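import Summits.QuantumAdvantage.AdviceFreeQNC0.AffBells28PeelingList
import Summits.QuantumAdvantage.AdviceFreeQNC0.AffBells28SubDoubleCount
import Summits.QuantumAdvantage.AdviceFreeQNC0.AffBells28Assembly
import HarnessLib

/-!
# `AffBells28.Leaf` PROVED — the two-class leaf; hence `IsoRefutes` and (NP₁) ⇐ `HIso` (planner qn-p1 g28, ROUND-27 §28.3; ask P-28a (iii))

Prover seat qn-prover-3 g14.  **`leaf : Leaf`**: vary the coins `S = S₁ ⊔ S₂` from `x₁`; if every row of `R` reading `S` is in the class
of `g₁` on `S₁` (zero on `S₂`, local `±`-twin of `g₁` on `S₁`) or in the class of `g₂` on `S₂`, and the XOR of the tests of `R` is constant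
on `SubFibre x₁ S`, then `pairCount` has constant parity there.  Proof (the planner's): on the sub-fibre `form β x' h = leafForm S x' h +
offForm S x₁ h` (`form_eq_leaf_add_off`); non-readers have constant forms, so `fires c' R x' = K + #(firing readers)` with `K` read at
`x₁`; a reader lies in exactly one class and is a twin or an anti-twin of its leader but not both (else it would vanish on `S`), and fires
iff the leader's leaf form is `±` its effective offset — so `#(firing readers) = pairCount x'` (`fires_eq_const_add_pairCount`).

Consequences: **`isoRefutes : IsoRefutes`** (`isoRefutes_of peelingList leaf`) and, with `subDoubleCount` and `AffBells27.affFrameLoss`,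
**`affBellsPolyLoss3_of_HIso : HIso → AffBellsPolyLoss3`** — the (NP₁) rung hinges on the ONE conjecture `HIso` of ROUND-27.
WHAT THIS IS NOT: `HIso` is NOT touched; separation NOT moved.
-/

namespace Summit.QuantumAdvantage.AdviceFreeQNC0

namespace AffBells28

open Finset Literature.Computability.QuantumComplexity Literature.Computability.QuantumComplexity.RingHLF
open AffBells23 AffBells26 Fib19

variable {N : ℕ}

/-! ### Forms on a sub-fibre -/

/-- On `SubFibre x₁ S` the form splits into the leaf part (coins of `S`, read at `x'`) and the off part (read at `x₁`). -/
theorem form_eq_leaf_add_off (β : Fin N → Fin N → ZMod 3) (S : Finset (Fin N)) {x₁ x' : Fin N → Bool}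
    (hx' : x' ∈ SubFibre x₁ S) (h : Fin N) : form β x' h = leafForm β S x' h + offForm β S x₁ h := by
  classical
  rw [mem_subFibre] at hx'
  unfold form leafForm offForm
  rw [← sum_add_sum_compl S, compl_eq_univ_sdiff]
  congr 1
  refine sum_congr rfl fun i hi => ?_
  rw [hx'.2.2 i (mem_sdiff.1 hi).2]

/-- The leaf form of a row vanishing on the coins is zero. -/
theorem leafForm_eq_zero (β : Fin N → Fin N → ZMod 3) {S : Finset (Fin N)} (x' : Fin N → Bool) {h : Fin N}
    (hz : ∀ i ∈ S, β h i = 0) : leafForm β S x' h = 0 := by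
  unfold leafForm
  refine sum_eq_zero fun i hi => ?_
  rw [hz i hi]
  split_ifs <;> rfl

/-- The leaf form over a disjoint union splits. -/
theorem leafForm_union (β : Fin N → Fin N → ZMod 3) {S₁ S₂ : Finset (Fin N)} (hdis : Disjoint S₁ S₂) (x' : Fin N → Bool)
    (h : Fin N) : leafForm β (S₁ ∪ S₂) x' h = leafForm β S₁ x' h + leafForm β S₂ x' h := by
  unfold leafForm
  rw [sum_union hdis]

/-- A local twin has the leader's leaf form. -/
theorem leafForm_of_twin (β : Fin N → Fin N → ZMod 3) {S : Finset (Fin N)} (x' : Fin N → Bool) {h g : Fin N}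
    (ht : LocTwin β S h g) : leafForm β S x' h = leafForm β S x' g := by
  unfold leafForm
  exact sum_congr rfl fun i hi => by rw [ht i hi]

/-- A local anti-twin has minus the leader's leaf form. -/
theorem leafForm_of_anti (β : Fin N → Fin N → ZMod 3) {S : Finset (Fin N)} (x' : Fin N → Bool) {h g : Fin N}
    (ha : LocAnti β S h g) : leafForm β S x' h = -leafForm β S x' g := by
  unfold leafForm
  rw [← sum_neg_distrib]
  exact sum_congr rfl fun i hi => by rw [ha i hi]; split_ifs <;> ring

/-- In `ZMod 3`, `a = −a` forces `a = 0`. -/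
theorem z3_eq_neg_self : ∀ a : ZMod 3, a = -a → a = 0 := by decide

/-- A reader of `Sj ∪ So` in the class on `Sj` does not vanish on `Sj`. -/
theorem not_zero_of_inClass (β : Fin N → Fin N → ZMod 3) {Sj So : Finset (Fin N)} {g h : Fin N}
    (hr : ∃ i ∈ Sj ∪ So, β h i ≠ 0) (hcl : InClass β Sj So g h) : ¬ ∀ i ∈ Sj, β h i = 0 := by
  intro hz
  obtain ⟨i, hi, hne⟩ := hr
  rw [mem_union] at hi
  rcases hi with hi | hi
  · exact hne (hz i hi)
  · exact hne (hcl.1 i hi)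

/-- A reader in the class on `Sj` is not both a twin and an anti-twin of the leader. -/
theorem not_twin_and_anti (β : Fin N → Fin N → ZMod 3) {Sj So : Finset (Fin N)} {g h : Fin N}
    (hr : ∃ i ∈ Sj ∪ So, β h i ≠ 0) (hcl : InClass β Sj So g h) : ¬ (LocTwin β Sj h g ∧ LocAnti β Sj h g) := by
  rintro ⟨ht, ha⟩
  apply not_zero_of_inClass β hr hcl
  intro i hi
  have h1 := ht i hi
  have h2 := ha i hi
  have hg : β g i = 0 := z3_eq_neg_self _ (h1.symm.trans h2)
  rw [h1, hg]

/-- **One class**: a reader `h` in the class of `g` on `Sj` fires at `x'` iff `(twin ∧ effOff h = t) ∨ (anti ∧ effOff h = −t)`,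
`t = leafForm Sj x' g`. -/
theorem fire_iff_of_inClass (β : Fin N → Fin N → ZMod 3) (c' : Fin N → ZMod 3) {x₁ x' : Fin N → Bool} {Sj So S : Finset (Fin N)}
    (hS : S = Sj ∪ So) (hdis : Disjoint Sj So) (hx' : x' ∈ SubFibre x₁ S) {g h : Fin N} (hr : ∃ i ∈ Sj ∪ So, β h i ≠ 0)
    (hcl : InClass β Sj So g h) :
    form β x' h = c' h ↔
      ((∀ i ∈ So, β h i = 0) ∧
        ((LocTwin β Sj h g ∧ effOff β c' x₁ S h = leafForm β Sj x' g) ∨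
          (LocAnti β Sj h g ∧ effOff β c' x₁ S h = -leafForm β Sj x' g))) := by
  have hform : form β x' h = leafForm β Sj x' h + offForm β S x₁ h := by
    rw [form_eq_leaf_add_off β S hx', hS, leafForm_union β hdis, leafForm_eq_zero β x' hcl.1, add_zero]
  have hna := not_twin_and_anti β hr hcl
  unfold effOff
  rw [hform]
  rcases hcl.2 with ht | ha
  · rw [leafForm_of_twin β x' ht]
    constructor
    · intro hf
      exact ⟨hcl.1, Or.inl ⟨ht, by rw [← hf]; ring⟩⟩
    · rintro ⟨-, ⟨-, he⟩ | ⟨ha, -⟩⟩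
      · linear_combination -he
      · exact absurd ⟨ht, ha⟩ hna
  · rw [leafForm_of_anti β x' ha]
    constructor
    · intro hf
      exact ⟨hcl.1, Or.inr ⟨ha, by rw [← hf]; ring⟩⟩
    · rintro ⟨-, ⟨ht, -⟩ | ⟨-, he⟩⟩
      · exact absurd ⟨ht, ha⟩ hna
      · have : offForm β S x₁ h = c' h + leafForm β Sj x' g := by linear_combination -he
        rw [this]; ring

/-- **The leaf count**: on `SubFibre x₁ (S₁ ∪ S₂)`, `fires c' R x' = K + pairCount x'` with `K` read at `x₁`. -/
theorem fires_eq_const_add_pairCount (β : Fin N → Fin N → ZMod 3) (c' : Fin N → ZMod 3) (R : Finset (Fin N))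
    {x₁ x' : Fin N → Bool} {S₁ S₂ : Finset (Fin N)} (hdis : Disjoint S₁ S₂) (g₁ g₂ : Fin N)
    (hcls : ∀ h ∈ readers β R (S₁ ∪ S₂), InClass β S₁ S₂ g₁ h ∨ InClass β S₂ S₁ g₂ h)
    (hx' : x' ∈ SubFibre x₁ (S₁ ∪ S₂)) :
    fires β c' R x' =
      ((R.filter fun h => ¬ ∃ i ∈ S₁ ∪ S₂, β h i ≠ 0).filter fun h => offForm β (S₁ ∪ S₂) x₁ h = c' h).card +
        pairCount β c' x₁ S₁ S₂ R g₁ g₂ x' := by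
  classical
  -- split the firing rows into readers and non-readers
  have e1 : fires β c' R x' = ((readers β R (S₁ ∪ S₂)).filter fun h => form β x' h = c' h).card +
      ((R.filter fun h => ¬ ∃ i ∈ S₁ ∪ S₂, β h i ≠ 0).filter fun h => form β x' h = c' h).card := by
    unfold fires readers
    rw [filter_comm, filter_comm (p := fun h => ¬ ∃ i ∈ S₁ ∪ S₂, β h i ≠ 0),
      card_filter_add_card_filter_not]
  -- non-readers: constant forms
  have e2 : ((R.filter fun h => ¬ ∃ i ∈ S₁ ∪ S₂, β h i ≠ 0).filter fun h => form β x' h = c' h) =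
      (R.filter fun h => ¬ ∃ i ∈ S₁ ∪ S₂, β h i ≠ 0).filter fun h => offForm β (S₁ ∪ S₂) x₁ h = c' h := by
    refine filter_congr fun h hh => ?_
    rw [mem_filter] at hh
    have hz : ∀ i ∈ S₁ ∪ S₂, β h i = 0 := by
      intro i hi
      by_contra hne
      exact hh.2 ⟨i, hi, hne⟩
    rw [form_eq_leaf_add_off β _ hx', leafForm_eq_zero β x' hz, zero_add]
  -- readers: the two classes
  have e3 : ((readers β R (S₁ ∪ S₂)).filter fun h => form β x' h = c' h).card = pairCount β c' x₁ S₁ S₂ R g₁ g₂ x' := by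
    unfold pairCount classCount
    rw [← card_union_of_disjoint]
    · rw [← filter_or]
      congr 1
      refine filter_congr fun h hh => ?_
      have hr : ∃ i ∈ S₁ ∪ S₂, β h i ≠ 0 := by
        have := hh; unfold readers at this; rw [mem_filter] at this; exact this.2
      rcases hcls h hh with c1 | c2
      · rw [fire_iff_of_inClass β c' rfl hdis hx' hr c1]
        constructor
        · exact Or.inl
        · rintro (h1 | h2)
          · exact h1
          · exact absurd (fun i hi => by exact h2.1 i hi) (not_zero_of_inClass β hr c1)
      · have hr' : ∃ i ∈ S₂ ∪ S₁, β h i ≠ 0 := by rw [union_comm]; exact hr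
        rw [fire_iff_of_inClass β c' (union_comm S₁ S₂) hdis.symm hx' hr' c2]
        constructor
        · exact Or.inr
        · rintro (h1 | h2)
          · exact absurd (fun i hi => by exact h1.1 i hi) (not_zero_of_inClass β hr' c2)
          · exact h2
    · rw [disjoint_filter]
      intro h hh h1 h2
      have hr : ∃ i ∈ S₁ ∪ S₂, β h i ≠ 0 := by
        have := hh; unfold readers at this; rw [mem_filter] at this; exact this.2
      obtain ⟨i, hi, hne⟩ := hr
      rw [mem_union] at hi
      rcases hi with hi | hi
      · exact hne (h2.1 i hi)
      · exact hne (h1.1 i hi)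
  rw [e1, e2, e3, add_comm]

/-- **`Leaf` holds.** -/
theorem leaf : Leaf := by
  intro N _ β c' R x₁ S₁ S₂ hdis g₁ g₂ hcls hS x' hx' x'' hx''
  have h := hS x' hx' x'' hx''
  rw [fires_eq_const_add_pairCount β c' R hdis g₁ g₂ hcls hx',
    fires_eq_const_add_pairCount β c' R hdis g₁ g₂ hcls hx''] at h
  omega

/-- **(I1) `IsoRefutes` holds**: an isolation witness forces a lost point in the window. -/
theorem isoRefutes : IsoRefutes := isoRefutes_of peelingList leaf

/-- **(NP₁) from `HIso` alone**: with `IsoRefutes`, `SubDoubleCount` and the frame side all proved, the inverse-polynomial loss rung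
`AffBellsPolyLoss3` follows from the one conjecture `HIso` of ROUND-27. -/
theorem affBellsPolyLoss3_of_HIso (hI : HIso) : AffBellsPolyLoss3 := polyLoss_of_iso' isoRefutes subDoubleCount hI

end AffBells28

end Summit.QuantumAdvantage.AdviceFreeQNC0
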